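import Summits.Ventures.QEC.Census.BB.A1s_n162_k12_a0a80268.Data
import HarnessLib

/-!
# Census row `A1s_n162_k12_a0a80268` — Brouwer–Zimmermann block verdicts 0…8 of the `Z` side (827658 codeword visits; fast twin `bzZBlockF`, `decide +kernel`, tier KERNEL). Part 1/3.
-/

set_option Elab.async false

namespace Summit.Ventures.QEC.Census.A1s_n162_k12_a0a80268

/-- Block 0 of the `Z` side replays (91962 codeword visits; fast twin `bzZBlockF`, `decide +kernel`). -/
theorem blkZ_0 : A1s_n162_k12_a0a80268.cert.bzZBlockF A1s_n162_k12_a0a80268.bz 0 = true := by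
  decide +kernel

/-- Block 1 of the `Z` side replays (91962 codeword visits; fast twin `bzZBlockF`, `decide +kernel`). -/
theorem blkZ_1 : A1s_n162_k12_a0a80268.cert.bzZBlockF A1s_n162_k12_a0a80268.bz 1 = true := by
  decide +kernel

/-- Block 2 of the `Z` side replays (91962 codeword visits; fast twin `bzZBlockF`, `decide +kernel`). -/
theorem blkZ_2 : A1s_n162_k12_a0a80268.cert.bzZBlockF A1s_n162_k12_a0a80268.bz 2 = true := by
  decide +kernel

/-- Block 3 of the `Z` side replays (91962 codeword visits; fast twin `bzZBlockF`, `decide +kernel`). -/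
theorem blkZ_3 : A1s_n162_k12_a0a80268.cert.bzZBlockF A1s_n162_k12_a0a80268.bz 3 = true := by
  decide +kernel

/-- Block 4 of the `Z` side replays (91962 codeword visits; fast twin `bzZBlockF`, `decide +kernel`). -/
theorem blkZ_4 : A1s_n162_k12_a0a80268.cert.bzZBlockF A1s_n162_k12_a0a80268.bz 4 = true := by
  decide +kernel

/-- Block 5 of the `Z` side replays (91962 codeword visits; fast twin `bzZBlockF`, `decide +kernel`). -/
theorem blkZ_5 : A1s_n162_k12_a0a80268.cert.bzZBlockF A1s_n162_k12_a0a80268.bz 5 = true := by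
  decide +kernel

/-- Block 6 of the `Z` side replays (91962 codeword visits; fast twin `bzZBlockF`, `decide +kernel`). -/
theorem blkZ_6 : A1s_n162_k12_a0a80268.cert.bzZBlockF A1s_n162_k12_a0a80268.bz 6 = true := by
  decide +kernel

/-- Block 7 of the `Z` side replays (91962 codeword visits; fast twin `bzZBlockF`, `decide +kernel`). -/
theorem blkZ_7 : A1s_n162_k12_a0a80268.cert.bzZBlockF A1s_n162_k12_a0a80268.bz 7 = true := by
  decide +kernel

/-- Block 8 of the `Z` side replays (91962 codeword visits; fast twin `bzZBlockF`, `decide +kernel`). -/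
theorem blkZ_8 : A1s_n162_k12_a0a80268.cert.bzZBlockF A1s_n162_k12_a0a80268.bz 8 = true := by
  decide +kernel

end Summit.Ventures.QEC.Census.A1s_n162_k12_a0a80268
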